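import Summits.QuantumFields.YangMills.Theorems.BalabanUVNodesN16PinnedLayer13CoPH
import Summits.QuantumFields.YangMills.Theorems.BalabanUVNodesN16PinnedDataSmallField

/-!
# Route «BalabanUVNodes», crux K3⁷ `SpineGivenEndpointR13SepCoPH` (stmt-QuantumFields-20544) — node N16 = NE3: THE PRODUCER OF K3⁷ v5's THREE N16 CONJUNCTS
# `N16PinnedLoose 𝔯 ℓ₃ B ∧ N16LettersEnd 2 g ℓ₃ ∧ N16RadiusMatch ℓ₃ B` (plan g82 K3V5-PRECUT 7ea7f0e25e496001, pub-ymgap INBOX l.28431: `N16RadiusMatch ℓ₃ B := ∀ F, 0 < B F ∧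
# (ℓ₃ F).ε ∕ B F ≤ (ℓ₃ F).b`, `GuardedReadingN16 := GuardedReading ∧ ⟨the three⟩`) FROM NODE N05's `h5` AND [B11] THEOREM 1 AT LEAF-06's TORUS INSTANCES (displayed), at the
# radius letter `B F := max (C F).B₃ ((ℓ₃ F).ε ∕ (ℓ₃ F).b)` — and, under that pin with the MATCH row, node N19's N16-side letter BY NAME

Cell `pub-ymgap`, seat `pub-ymgap-dag-n16-e` (R134 acceleration seat (a), strategy s2 = BY-NAME KNIT at the record; HUMAN RULING D-0062; chair R424 venue), generation 16,
module 45 (THEOREMS ONLY, 0 `def`, 0 `sorry`, standard axioms).  `--kind proof --supports stmt-QuantumFields-20544 --as helper` (count-neutral; the file proves NO registered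
stub — it produces the N16 conjuncts of `stub_rates13H`'s witness modulo the displayed in-edges).  `bears_on: R4∕N16 · edges N05 → N16, N07 → N16 · out-edge N16 → N19 ∕ N21`.
Over module 43 `…N16PinnedLayer13CoPH` (p600861: the pins, `N16LettersEnd`, `N16HolderAtReading`, faces), module 44 `…N16PinnedDataSmallField` (p602660: the N19-side faces) and
dag-n16-w1's file 6 v1.2 `…N16H7LooseOfThm1At.exists_letters_n16HolderAt_looseSub_of_h5_thm1At` (p602214: the per-family producer at ANY letter-dependent data set inside print's
(7)-ball) — CITED BY NAME, none edited; the skeleton's `N16RadiusMatch` ∕ `GuardedReadingN16` live in the planner's file and are spelled out here, not named.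

THE POINT (this seat's ANSWER (β16) l.28163, adopted by the planner).  The loose pin's radius letter `B` needs the row `0 < B F ∧ (ℓ₃ F).ε ∕ B F ≤ (ℓ₃ F).b`: `0 < B` refuses the
empty-data junk road, `ε∕B ≤ b` is what node N19's link reading takes at `ε₁ := (ℓ₃ F).ε ∕ B F` (dag-n19-d (v′-16) `ε₁ ≤ R.ne3.b ∧ R.ne3.dom ⊆ sfClass 4 … ε₁ 0`).  It COSTS NOTHING
beyond Theorem 1: dag-n16-w1's producer delivers dag-n16-c's β-sentence at ANY data set `D ℓ` inside the (7)-ball of radius `ℓ.ε ∕ B₃`; take `D ℓ` = the ball of radius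
`ℓ.ε ∕ max B₃ (ℓ.ε ∕ ℓ.b)` — inside the (7)-ball since `max ≥ B₃` (`sfClass_mono`), and `ε ∕ max B₃ (ε∕b) ≤ ε ∕ (ε∕b) = b` (`radiusMatch_max`).  §2 ★
`exists_letters_n16HolderAtReading_loose_of_h5_thm1At_match`: `∃ ℓ₃ B, N16LettersEnd N g ℓ₃ ∧ (∀ F, 0 < B F ∧ (ℓ₃ F).ε ∕ B F ≤ (ℓ₃ F).b) ∧ (∀ F, (C F).B₃ ≤ B F) ∧ ∀ 𝔯,
N16PinnedLoose 𝔯 ℓ₃ B → N16HolderAtReading 𝔯 β` — v5's three N16 conjuncts of the stub-1 witness, modulo `h5` and Theorem 1.  §3: under the pin with the MATCH row node N19 reads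
`(ℓ₃ F).ε ∕ B F ≤ R.ne3.b ∧ R.ne3.dom ⊆ sfClass … ((ℓ₃ F).ε ∕ B F) 0` and the bundle's NE3 letters ARE `ℓ₃ F`'s (`n19_domLetter_of_pinnedLoose_match`, `ne3_letters_of_pinnedLoose`).
§4 (for the located next row (t-N16b) ∕ the n19 lanes' `c'`-guard, should they name it): the same producer with the radius ALSO below `1∕4` and below `c'∕4` for a `c'` with
`gradConst 4 c' = g F` (`…_match_n19rows`; `gradConst 4 c = 4·#Plane 4·c²` is onto `]0,∞[`, `exists_gradConst_eq`).

HONEST FRAMING.  Kernel bookkeeping by name; no estimate; `h5` (node N05's Thm-4 ∕ Prop-3 bodies at exponent β on the pinned all-torus sub-family) and [Balaban1985Variational]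
Theorem 1 at leaf-06's torus instances (`hT`) are DISPLAYED hypotheses asserted for no family; nothing of Bałaban asserted; N16 ∕ N19 NOT discharged; no stub of K3⁷ closed; the
skeleton is the planner's and is NOT edited; counts UNMOVED (typed 28∕28 · discharged 5∕27, A 5∕28); one finite four-torus at fixed ε — NOT ℝ⁴ ∕ infinite volume ∕ OS ∕ mass
gap ∕ Clay.
-/

set_option autoImplicit false

open scoped BigOperators Matrix Matrix.Norms.L2Operator
open NormedSpace

namespace Summit.QuantumFields.YangMills.BalabanUVNodes.N16PinnedLooseMatch

open Literature.MathematicalPhysics.QuantumFieldTheory.Balaban1983to89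
open Literature.MathematicalPhysics.QuantumFieldTheory.Balaban1983to89.T4Continuum (T4Family ULoop)
open B7Prop1Explicit B7Prop2Explicit MatrixLog UnitaryModel
open T4AveragingDeficitWall hiding Site Plaq Bond
open B7Prop3Flat (c3)
open B8LeafModelZd (ZdIdx)
open B8LeafModelZd3 (zdGF3)
open Node00 (Stage13HParams NE3Objects₁₁ NE3Letters₁₁ ne3ConstLayerOfRecord₁₁ ne3NperOfRecord₁₁ ne3DomOfRecord₁₁ MatA)
open Summit.QuantumFields.BalabanUV.T4Continuum
open MinimalActionRate (sfClass)
open MinimalActionRefine (gradConst)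
open MinimalActionDictionary (torusVP RadiiMono sfClass_mono)
open AveragingDeficitLatticeH2Prep (fd)
open B11Thm1 (Thm1At)
open YMDAG.UVSplit (NE3Carriers ne3OfRecord₁₁ RateReading₁₃CoPH rateCarriersOfRecord₁₃CoPH)
open Summit.QuantumFields.YangMills.BalabanUVNodes.N16HolderDefs (N16HolderAt)
open Summit.QuantumFields.YangMills.BalabanUVNodes.N16HolderRegime (InEndRegimeH radiusOfRecordH constOfRecordH)
open Summit.QuantumFields.YangMills.BalabanUVNodes.N16LeafSlotAllTorus (n16HolderAt_of_inEndRegimeH_leafSlotHolderAT)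
open Summit.QuantumFields.YangMills.BalabanUVNodes.N16H7LooseOfThm1At (exists_letters_inEndRegimeH_leafSlotHolderAT_of_h5_thm1At)
open Summit.QuantumFields.YangMills.BalabanUVNodes.N16PinnedLayer13CoPH (N16PinnedLoose N16LettersEnd N16HolderAtReading inEndRegimeH_loose_iff
  rateCarriers_ne3_of_pinnedLoose n16HolderAtReading_of_pinnedLoose)
open Summit.QuantumFields.YangMills.BalabanUVNodes.N16PinnedDataSmallField (sfClass_zero_mono dom_subset_sfClass_of_pinnedLoose)

noncomputable section

variable {N : ℕ} [NeZero N]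

/-! ## §1 The match radius -/

omit [NeZero N] in
/-- **dag-n16-c's β-sentence is ANTITONE IN THE DATA** (`CovRootHolder … dom = ∀ k ≥ 1, ∀ V ∈ dom, …`): it descends from an NE3 object to the same object with FEWER data. [folklore] -/
theorem n16HolderAt_anti_dom (F : T4Family) {o : NE3Objects₁₁ N} {D : Set ((Fin 4 → ℤ) → Fin 4 → (MatA N)ˣ)} (hD : D ⊆ o.dom) {β : ℝ}
    (h : N16HolderAt (ne3OfRecord₁₁ F o) β) : N16HolderAt (ne3OfRecord₁₁ F { o with dom := D }) β :=
  fun k hk V hV => h k hk V (hD hV)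

omit [NeZero N] in
/-- **THE LOOSE OBJECTS ARE NESTED IN THE RADIUS LETTER**: for `0 ≤ ε` and `0 < B' ≤ B` the data cut at radius `ε ∕ B` lie inside the data cut at radius `ε ∕ B'`. [folklore] -/
theorem looseDom_anti (F : T4Family) {ε B B' : ℝ} (hε : 0 ≤ ε) (hB' : 0 < B') (hBB : B' ≤ B) :
    ({V | V ∈ ne3DomOfRecord₁₁ F N 0 0 ∧ V ∈ sfClass 4 F.L (ne3NperOfRecord₁₁ F 0 0) (ε / B) 0} : Set ((Fin 4 → ℤ) → Fin 4 → (MatA N)ˣ)) ⊆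
      {V | V ∈ ne3DomOfRecord₁₁ F N 0 0 ∧ V ∈ sfClass 4 F.L (ne3NperOfRecord₁₁ F 0 0) (ε / B') 0} :=
  fun _ hV => ⟨hV.1, sfClass_zero_mono (div_le_div_of_nonneg_left hε hB' hBB) hV.2⟩

/-- **THE MATCH RADIUS LETTER** `B := max B₃ (ε ∕ b)` (`0 < ε`, `0 < b`, `0 < B₃`): `0 < B`, `B₃ ≤ B` and `ε ∕ B ≤ b`. [folklore] -/
theorem radiusMatch_max {ε b B₃ : ℝ} (hε : 0 < ε) (hb : 0 < b) (hB₃ : 0 < B₃) :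
    0 < max B₃ (ε / b) ∧ B₃ ≤ max B₃ (ε / b) ∧ ε / max B₃ (ε / b) ≤ b := by
  refine ⟨lt_max_of_lt_left hB₃, le_max_left _ _, ?_⟩
  calc ε / max B₃ (ε / b) ≤ ε / (ε / b) := div_le_div_of_nonneg_left hε.le (div_pos hε hb) (le_max_right _ _)
    _ = b := by rw [div_div_eq_mul_div, mul_div_cancel_left₀ b hε.ne']

/-- **THE N19-GUARDED MATCH RADIUS LETTER** `B := max (max B₃ (ε ∕ b)) (max (4ε) (4ε ∕ c'))` (`0 < ε, b, B₃, c'`): `0 < B`, `B₃ ≤ B`, `ε ∕ B ≤ b`, `ε ∕ B ≤ 1∕4`, `4·(ε ∕ B) ≤ c'`. [folklore] -/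
theorem radiusMatch_max₄ {ε b B₃ c' : ℝ} (hε : 0 < ε) (hb : 0 < b) (hB₃ : 0 < B₃) (hc' : 0 < c') :
    0 < max (max B₃ (ε / b)) (max (4 * ε) (4 * ε / c')) ∧ B₃ ≤ max (max B₃ (ε / b)) (max (4 * ε) (4 * ε / c')) ∧
      ε / max (max B₃ (ε / b)) (max (4 * ε) (4 * ε / c')) ≤ b ∧ ε / max (max B₃ (ε / b)) (max (4 * ε) (4 * ε / c')) ≤ 1 / 4 ∧
      4 * (ε / max (max B₃ (ε / b)) (max (4 * ε) (4 * ε / c'))) ≤ c' := by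
  set B := max (max B₃ (ε / b)) (max (4 * ε) (4 * ε / c')) with hB
  have hB0 : 0 < B := lt_max_of_lt_left (lt_max_of_lt_left hB₃)
  refine ⟨hB0, (le_max_left _ _).trans (le_max_left _ _), ?_, ?_, ?_⟩
  · calc ε / B ≤ ε / (ε / b) := div_le_div_of_nonneg_left hε.le (div_pos hε hb) ((le_max_right _ _).trans (le_max_left _ _))
      _ = b := by rw [div_div_eq_mul_div, mul_div_cancel_left₀ b hε.ne']
  · calc ε / B ≤ ε / (4 * ε) := div_le_div_of_nonneg_left hε.le (by positivity) ((le_max_left _ _).trans (le_max_right _ _))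
      _ = 1 / 4 := by field_simp
  · have h1 : ε / B ≤ ε / (4 * ε / c') := div_le_div_of_nonneg_left hε.le (by positivity) ((le_max_right _ _).trans (le_max_right _ _))
    have h2 : ε / (4 * ε / c') = c' / 4 := by field_simp
    linarith only [h1, h2]

/-- The gradient-letter inverse: for `g > 0` some `c' > 0` has `gradConst 4 c' = g` (`gradConst 4 c = 4·#Plane 4·c²`; `#Plane 4 ≥ 1`, the plane `(0,1)`). [folklore] -/
theorem exists_gradConst_eq {g : ℝ} (hg : 0 < g) : ∃ c' : ℝ, 0 < c' ∧ gradConst 4 c' = g := by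
  have hcard : 0 < (Fintype.card (T4AveragingDeficitWall.Plane 4) : ℝ) := by
    have : Nonempty (T4AveragingDeficitWall.Plane 4) := ⟨⟨((0 : Fin 4), (1 : Fin 4)), by decide⟩⟩
    exact_mod_cast Fintype.card_pos
  refine ⟨Real.sqrt (g / (4 * Fintype.card (T4AveragingDeficitWall.Plane 4))), Real.sqrt_pos.2 (by positivity), ?_⟩
  unfold gradConst
  rw [Real.sq_sqrt (by positivity)]
  push_cast
  field_simp

/-! ## §2 The producer of v5's three N16 conjuncts, from `h5` and Theorem 1 -/

section Producer

variable {β : ℝ} (hβ0 : 0 ≤ β) (hβ1 : β ≤ 1)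
include hβ0 hβ1

/-- **★ THE PRODUCER OF K3⁷ v5's THREE N16 CONJUNCTS** — `N16PinnedLoose 𝔯 ℓ₃ B` (as the hypothesis every reading must meet), `N16LettersEnd N g ℓ₃`, and the MATCH row
`∀ F, 0 < B F ∧ (ℓ₃ F).ε ∕ B F ≤ (ℓ₃ F).b` (= `N16RadiusMatch ℓ₃ B` of the skeleton, spelled out) — FROM node N05's `h5` (37ᴴ's, VERBATIM), `g F > 0`, and per family leaf-06's
Theorem-1 reading exactly as in dag-n16-w1's files (`G F`, `RadiiMono`, the (9)_{β₀=1} interface binder `hG`, `C F : B11Thm1.Consts` with `M(ε₁) ≥ 7∕2` on `(0,a₁]`, `hT : ∀ k,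
Thm1At (C F) (torusVP 4 F.L Nper (G F) (k+1))` — DISPLAYED): with `B F := max (C F).B₃ ((ℓ₃ F).ε ∕ (ℓ₃ F).b)` (so also `(C F).B₃ ≤ B F`: print's (7)-ball or smaller), every reading
pinned LOOSE at `ℓ₃, B` satisfies the N16 conjunct at every tuple and run length.  dag-n16-w1's `exists_letters_inEndRegimeH_leafSlotHolderAT_of_h5_thm1At` (radius `ε ∕ B₃`) ∘ module 32's closer ∘ antitonicity in
the data (§1) ∘ module 43's `n16HolderAtReading_of_pinnedLoose`. [cite: Balaban1985Variational, Thm 1 (8)–(10) p.279] [folklore] -/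
theorem exists_letters_n16HolderAtReading_loose_of_h5_thm1At_match {g : T4Family → ℝ} (hg : ∀ F, 0 < g F)
    (h5 : ∀ F : T4Family, letI : CStarAlgebra (Matrix (Fin N) (Fin N) ℂ) := {}
      ∃ (len : Site 4 → ℝ) (c₁ c₁' B₁' cP C₂ B₀β : ℝ) (inp : B8.B9Inputs),
        (∀ v : Site 4, 0 < len v → 1 ≤ len v) ∧ (∀ μ : Fin 4, len (e μ) = 1) ∧ 0 < B₁' ∧ 5 * ((4 : ℕ) : ℝ) * F.L * inp.B₀ ≤ B₁' ∧ 0 < c₁' ∧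
        (∀ α₀ α₁ : ℝ, 0 < α₀ → 0 < α₁ → α₀ + α₁ ≤ c₁' →
          α₀ + α₁ ≤ c₁ ∧ C0 4 * (2 * α₀) ≤ 1 / 3 ∧ 4 * α₀ ≤ c2' 4 F.L ∧ 16 * (B₁' * (α₀ + α₁)) ≤ 1 ∧
          Real.exp (4 * (800 * (((4 : ℕ) : ℝ) + 1) ^ 2 * (((4 : ℕ) : ℝ) + 4)) * α₀) * (1 + 8 * (131072 * (((4 : ℕ) : ℝ) + 1) ^ 2) * (B₁' * (α₀ + α₁))) ≤ 2 ∧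
          2 * (B₁' * (α₀ + α₁)) ≤ c3 4 F.L ∧ ((4 : ℕ) : ℝ) * F.L * α₁ ≤ 1 / 8 ∧ α₀ ≤ cP ∧ α₁ ≤ cP ∧ B₁' * (α₀ + α₁) ≤ cP ∧
          2 * (B₁' * (α₀ + α₁)) ^ 2 + 20 * ((4 : ℕ) : ℝ) * α₀ * (B₁' * (α₀ + α₁)) + 2 * C₂ * (B₁' * (α₀ + α₁)) ^ 2 ≤ α₀ + α₁) ∧
        B8.Thm4Body c₁ B₁' (fun i : {i : ZdIdx 4 F.L // (∀ j, i.Ω j = Set.univ) ∧ (∀ m j, i.Λs m j = {_y | j = m}) ∧ (∀ m j, i.Λb m j = {_c | j = m}) ∧ i.η = ((F.L : ℝ)⁻¹) ^ i.k} => (zdGF3 (Matrix (Fin N) (Fin N) ℂ) F.L β len i.1).toGFData) ∧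
        B8.Prop3Body cP 4 (F.L : ℝ) C₂ inp B₀β (fun i : {i : ZdIdx 4 F.L // (∀ j, i.Ω j = Set.univ) ∧ (∀ m j, i.Λs m j = {_y | j = m}) ∧ (∀ m j, i.Λb m j = {_c | j = m}) ∧ i.η = ((F.L : ℝ)⁻¹) ^ i.k} => (zdGF3 (Matrix (Fin N) (Fin N) ℂ) F.L β len i.1).toGFData2))
    {G : T4Family → (Site 4 → Fin 4 → (MatA N)ˣ) → Site 4 → ℕ → ℝ → ℝ → ℝ → Prop} (hGm : ∀ F, RadiiMono 4 (G F))
    (hG : ∀ (F : T4Family) (U : Site 4 → Fin 4 → (MatA N)ˣ) (x : Site 4) (K : ℕ) (α₀ α₁ α₂ : ℝ), 2 ≤ K → G F U x K α₀ α₁ α₂ →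
      ∃ (u : Site 4 → (MatA N)ˣ) (a : Site 4 → Fin 4 → MatA N),
        (∀ z, u z ∈ unitaryUnits (MatA N)) ∧
        (∀ (y : Site 4) (τ : Fin 4), l1 (y - x) ≤ 2 → ((gaugeAct u U y τ : (MatA N)ˣ) : MatA N) = exp (a y τ)) ∧
        (∀ (y : Site 4) (τ : Fin 4), l1 (y - x) ≤ 2 → ‖a y τ‖ ≤ α₀) ∧
        (∀ (y : Site 4) (τ i : Fin 4), l1 (y - x) ≤ 1 → ‖fd i (fun z => a z τ) y‖ ≤ α₁) ∧
        (∀ (τ i l : Fin 4), ‖fd i (fd l (fun z => a z τ)) x‖ ≤ α₂))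
    (C : T4Family → B11Thm1.Consts) (hM : ∀ (F : T4Family) (e : ℝ), 0 < e → e ≤ (C F).a₁ → 7 / 2 ≤ (C F).Mfun e)
    (hT : ∀ (F : T4Family) (k : ℕ), Thm1At (C F) (torusVP 4 F.L (ne3NperOfRecord₁₁ F 0 0) (G F) (k + 1))) :
    ∃ (ℓ₃ : T4Family → NE3Letters₁₁) (B : T4Family → ℝ), N16LettersEnd N g ℓ₃ ∧
      (∀ F : T4Family, 0 < B F ∧ (ℓ₃ F).ε / B F ≤ (ℓ₃ F).b) ∧ (∀ F : T4Family, (C F).B₃ ≤ B F) ∧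
      ∀ 𝔯 : RateReading₁₃CoPH N, N16PinnedLoose 𝔯 ℓ₃ B → N16HolderAtReading 𝔯 β := by
  -- per family: dag-n16-w1's producer at print's (7)-ball of radius `ε ∕ B₃`, then ANTITONICITY in the data down to the radius `ε ∕ max B₃ (ε∕b) ≤ ε ∕ B₃`
  choose ℓ₃ hℓ₃ using fun F => exists_letters_inEndRegimeH_leafSlotHolderAT_of_h5_thm1At (N := N) F (hg F) (h5 F) (hGm F) (hG F) (C F) (hM F) (hT F)
  have hε0 : ∀ F, 0 < (ℓ₃ F).ε := fun F => (hℓ₃ F).2.2.2.2.2.2.1.2.2.2.1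
  have hm : ∀ F, 0 < max (C F).B₃ ((ℓ₃ F).ε / (ℓ₃ F).b) ∧ (C F).B₃ ≤ max (C F).B₃ ((ℓ₃ F).ε / (ℓ₃ F).b) ∧
      (ℓ₃ F).ε / max (C F).B₃ ((ℓ₃ F).ε / (ℓ₃ F).b) ≤ (ℓ₃ F).b := fun F => radiusMatch_max (hε0 F) (hℓ₃ F).2.2.2.1 (C F).B₃_pos
  refine ⟨ℓ₃, fun F => max (C F).B₃ ((ℓ₃ F).ε / (ℓ₃ F).b),
    fun F => ⟨(hℓ₃ F).1, (hℓ₃ F).2.1, (hℓ₃ F).2.2.1, (hℓ₃ F).2.2.2.1, (hℓ₃ F).2.2.2.2.1, (hℓ₃ F).2.2.2.2.2.1,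
      (inEndRegimeH_loose_iff F (ℓ₃ F) _).1 (hℓ₃ F).2.2.2.2.2.2.1⟩, fun F => ⟨(hm F).1, (hm F).2.2⟩, fun F => (hm F).2.1,
    fun 𝔯 hpin => n16HolderAtReading_of_pinnedLoose β hpin fun F => ?_⟩
  exact n16HolderAt_anti_dom F (o := { ne3ConstLayerOfRecord₁₁ F N (ℓ₃ F) with
      dom := {V | V ∈ ne3DomOfRecord₁₁ F N 0 0 ∧ V ∈ sfClass 4 F.L (ne3NperOfRecord₁₁ F 0 0) ((ℓ₃ F).ε / (C F).B₃) 0} })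
    (looseDom_anti F (hε0 F).le (C F).B₃_pos (hm F).2.1) (n16HolderAt_of_inEndRegimeH_leafSlotHolderAT (hℓ₃ F).2.2.2.2.2.2.1 hβ0 hβ1 (hℓ₃ F).2.2.2.2.2.2.2)

/-- **★ THE SAME PRODUCER WITH NODE N19's TWO FURTHER RADIUS GUARDS** `ε₁ ≤ 1∕4 ∧ 4·ε₁ ≤ c'` (for A `c' > 0` with `gradConst 4 c' = g F`) — the shape a located next row
(t-N16b) ∕ the n19 lanes' `c'`-guard would take; `B F := max (max B₃ (ε∕b)) (max (4ε) (4ε∕c'))`.  Not consumed by v5; typed so that a later re-cut has its producer in the tree.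
[cite: Balaban1985Variational, Thm 1 (8)–(10) p.279] [folklore] -/
theorem exists_letters_n16HolderAtReading_loose_of_h5_thm1At_match_n19rows {g : T4Family → ℝ} (hg : ∀ F, 0 < g F)
    (h5 : ∀ F : T4Family, letI : CStarAlgebra (Matrix (Fin N) (Fin N) ℂ) := {}
      ∃ (len : Site 4 → ℝ) (c₁ c₁' B₁' cP C₂ B₀β : ℝ) (inp : B8.B9Inputs),
        (∀ v : Site 4, 0 < len v → 1 ≤ len v) ∧ (∀ μ : Fin 4, len (e μ) = 1) ∧ 0 < B₁' ∧ 5 * ((4 : ℕ) : ℝ) * F.L * inp.B₀ ≤ B₁' ∧ 0 < c₁' ∧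
        (∀ α₀ α₁ : ℝ, 0 < α₀ → 0 < α₁ → α₀ + α₁ ≤ c₁' →
          α₀ + α₁ ≤ c₁ ∧ C0 4 * (2 * α₀) ≤ 1 / 3 ∧ 4 * α₀ ≤ c2' 4 F.L ∧ 16 * (B₁' * (α₀ + α₁)) ≤ 1 ∧
          Real.exp (4 * (800 * (((4 : ℕ) : ℝ) + 1) ^ 2 * (((4 : ℕ) : ℝ) + 4)) * α₀) * (1 + 8 * (131072 * (((4 : ℕ) : ℝ) + 1) ^ 2) * (B₁' * (α₀ + α₁))) ≤ 2 ∧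
          2 * (B₁' * (α₀ + α₁)) ≤ c3 4 F.L ∧ ((4 : ℕ) : ℝ) * F.L * α₁ ≤ 1 / 8 ∧ α₀ ≤ cP ∧ α₁ ≤ cP ∧ B₁' * (α₀ + α₁) ≤ cP ∧
          2 * (B₁' * (α₀ + α₁)) ^ 2 + 20 * ((4 : ℕ) : ℝ) * α₀ * (B₁' * (α₀ + α₁)) + 2 * C₂ * (B₁' * (α₀ + α₁)) ^ 2 ≤ α₀ + α₁) ∧
        B8.Thm4Body c₁ B₁' (fun i : {i : ZdIdx 4 F.L // (∀ j, i.Ω j = Set.univ) ∧ (∀ m j, i.Λs m j = {_y | j = m}) ∧ (∀ m j, i.Λb m j = {_c | j = m}) ∧ i.η = ((F.L : ℝ)⁻¹) ^ i.k} => (zdGF3 (Matrix (Fin N) (Fin N) ℂ) F.L β len i.1).toGFData) ∧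
        B8.Prop3Body cP 4 (F.L : ℝ) C₂ inp B₀β (fun i : {i : ZdIdx 4 F.L // (∀ j, i.Ω j = Set.univ) ∧ (∀ m j, i.Λs m j = {_y | j = m}) ∧ (∀ m j, i.Λb m j = {_c | j = m}) ∧ i.η = ((F.L : ℝ)⁻¹) ^ i.k} => (zdGF3 (Matrix (Fin N) (Fin N) ℂ) F.L β len i.1).toGFData2))
    {G : T4Family → (Site 4 → Fin 4 → (MatA N)ˣ) → Site 4 → ℕ → ℝ → ℝ → ℝ → Prop} (hGm : ∀ F, RadiiMono 4 (G F))
    (hG : ∀ (F : T4Family) (U : Site 4 → Fin 4 → (MatA N)ˣ) (x : Site 4) (K : ℕ) (α₀ α₁ α₂ : ℝ), 2 ≤ K → G F U x K α₀ α₁ α₂ →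
      ∃ (u : Site 4 → (MatA N)ˣ) (a : Site 4 → Fin 4 → MatA N),
        (∀ z, u z ∈ unitaryUnits (MatA N)) ∧
        (∀ (y : Site 4) (τ : Fin 4), l1 (y - x) ≤ 2 → ((gaugeAct u U y τ : (MatA N)ˣ) : MatA N) = exp (a y τ)) ∧
        (∀ (y : Site 4) (τ : Fin 4), l1 (y - x) ≤ 2 → ‖a y τ‖ ≤ α₀) ∧
        (∀ (y : Site 4) (τ i : Fin 4), l1 (y - x) ≤ 1 → ‖fd i (fun z => a z τ) y‖ ≤ α₁) ∧
        (∀ (τ i l : Fin 4), ‖fd i (fd l (fun z => a z τ)) x‖ ≤ α₂))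
    (C : T4Family → B11Thm1.Consts) (hM : ∀ (F : T4Family) (e : ℝ), 0 < e → e ≤ (C F).a₁ → 7 / 2 ≤ (C F).Mfun e)
    (hT : ∀ (F : T4Family) (k : ℕ), Thm1At (C F) (torusVP 4 F.L (ne3NperOfRecord₁₁ F 0 0) (G F) (k + 1))) :
    ∃ (ℓ₃ : T4Family → NE3Letters₁₁) (B : T4Family → ℝ) (c' : T4Family → ℝ), N16LettersEnd N g ℓ₃ ∧
      (∀ F : T4Family, 0 < B F ∧ (ℓ₃ F).ε / B F ≤ (ℓ₃ F).b) ∧ (∀ F : T4Family, (C F).B₃ ≤ B F) ∧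
      (∀ F : T4Family, 0 < c' F ∧ gradConst 4 (c' F) = g F ∧ (ℓ₃ F).ε / B F ≤ 1 / 4 ∧ 4 * ((ℓ₃ F).ε / B F) ≤ c' F) ∧
      ∀ 𝔯 : RateReading₁₃CoPH N, N16PinnedLoose 𝔯 ℓ₃ B → N16HolderAtReading 𝔯 β := by
  choose c' hc' using fun F => exists_gradConst_eq (hg F)
  choose ℓ₃ hℓ₃ using fun F => exists_letters_inEndRegimeH_leafSlotHolderAT_of_h5_thm1At (N := N) F (hg F) (h5 F) (hGm F) (hG F) (C F) (hM F) (hT F)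
  have hε0 : ∀ F, 0 < (ℓ₃ F).ε := fun F => (hℓ₃ F).2.2.2.2.2.2.1.2.2.2.1
  have hm := fun F => radiusMatch_max₄ (hε0 F) (hℓ₃ F).2.2.2.1 (C F).B₃_pos (hc' F).1
  refine ⟨ℓ₃, fun F => max (max (C F).B₃ ((ℓ₃ F).ε / (ℓ₃ F).b)) (max (4 * (ℓ₃ F).ε) (4 * (ℓ₃ F).ε / c' F)), c',
    fun F => ⟨(hℓ₃ F).1, (hℓ₃ F).2.1, (hℓ₃ F).2.2.1, (hℓ₃ F).2.2.2.1, (hℓ₃ F).2.2.2.2.1, (hℓ₃ F).2.2.2.2.2.1,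
      (inEndRegimeH_loose_iff F (ℓ₃ F) _).1 (hℓ₃ F).2.2.2.2.2.2.1⟩, fun F => ⟨(hm F).1, (hm F).2.2.1⟩, fun F => (hm F).2.1,
    fun F => ⟨(hc' F).1, (hc' F).2, (hm F).2.2.2.1, (hm F).2.2.2.2⟩, fun 𝔯 hpin => n16HolderAtReading_of_pinnedLoose β hpin fun F => ?_⟩
  exact n16HolderAt_anti_dom F (o := { ne3ConstLayerOfRecord₁₁ F N (ℓ₃ F) with
      dom := {V | V ∈ ne3DomOfRecord₁₁ F N 0 0 ∧ V ∈ sfClass 4 F.L (ne3NperOfRecord₁₁ F 0 0) ((ℓ₃ F).ε / (C F).B₃) 0} })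
    (looseDom_anti F (hε0 F).le (C F).B₃_pos (hm F).2.1) (n16HolderAt_of_inEndRegimeH_leafSlotHolderAT (hℓ₃ F).2.2.2.2.2.2.1 hβ0 hβ1 (hℓ₃ F).2.2.2.2.2.2.2)

end Producer

/-! ## §3 Under the loose pin with the MATCH row: node N19's N16-side letter BY NAME -/

/-- **★ NODE N19's N16-SIDE LETTER UNDER THE LOOSE PIN WITH THE MATCH ROW**: at every tuple and run length of a reading pinned LOOSE at `ℓ₃, B` with `∀ F, 0 < B F ∧
(ℓ₃ F).ε ∕ B F ≤ (ℓ₃ F).b` (v5's `N16RadiusMatch ℓ₃ B`, spelled out), the radius `ε₁ := (ℓ₃ F).ε ∕ B F` satisfies `ε₁ ≤ R.ne3.b ∧ R.ne3.dom ⊆ sfClass 4 R.ne3.L R.ne3.Nper ε₁ 0` at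
`R := rateCarriersOfRecord₁₃CoPH 𝔯 F θ hP g₀ os k` (dag-n19-d (v′-16); module 44's face + module 43's `rateCarriers_ne3_of_pinnedLoose`). [folklore] -/
theorem n19_domLetter_of_pinnedLoose_match {𝔯 : RateReading₁₃CoPH N} {ℓ₃ : T4Family → NE3Letters₁₁} {B : T4Family → ℝ}
    (hmatch : ∀ F : T4Family, 0 < B F ∧ (ℓ₃ F).ε / B F ≤ (ℓ₃ F).b) (hpin : N16PinnedLoose 𝔯 ℓ₃ B)
    (F : T4Family) (θ : Stage13HParams F N) (hP : θ.Provisos₁₃CoPH F N) (g₀ : ℕ → ℝ) (os : List (ULoop F)) (k : ℕ) :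
    (ℓ₃ F).ε / B F ≤ (rateCarriersOfRecord₁₃CoPH 𝔯 F θ hP g₀ os k).ne3.b ∧
      (rateCarriersOfRecord₁₃CoPH 𝔯 F θ hP g₀ os k).ne3.dom ⊆
        sfClass 4 (rateCarriersOfRecord₁₃CoPH 𝔯 F θ hP g₀ os k).ne3.L (rateCarriersOfRecord₁₃CoPH 𝔯 F θ hP g₀ os k).ne3.Nper ((ℓ₃ F).ε / B F) 0 := by
  refine ⟨?_, dom_subset_sfClass_of_pinnedLoose 𝔯 ℓ₃ B hpin F θ hP g₀ os k le_rfl⟩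
  rw [rateCarriers_ne3_of_pinnedLoose hpin F θ hP g₀ os k]
  exact (hmatch F).2

/-- … and the bundle's NE3 LETTERS are `ℓ₃ F`'s, the period `2L^m`, the block factor `F.L` (`rfl` after the pin) — what N19 reads as `R.ne3.ε ∕ .b ∕ .g ∕ .Nper ∕ .L`. [folklore] -/
theorem ne3_letters_of_pinnedLoose {𝔯 : RateReading₁₃CoPH N} {ℓ₃ : T4Family → NE3Letters₁₁} {B : T4Family → ℝ} (hpin : N16PinnedLoose 𝔯 ℓ₃ B)
    (F : T4Family) (θ : Stage13HParams F N) (hP : θ.Provisos₁₃CoPH F N) (g₀ : ℕ → ℝ) (os : List (ULoop F)) (k : ℕ) :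
    (rateCarriersOfRecord₁₃CoPH 𝔯 F θ hP g₀ os k).ne3.ε = (ℓ₃ F).ε ∧ (rateCarriersOfRecord₁₃CoPH 𝔯 F θ hP g₀ os k).ne3.b = (ℓ₃ F).b ∧
      (rateCarriersOfRecord₁₃CoPH 𝔯 F θ hP g₀ os k).ne3.g = (ℓ₃ F).g ∧ (rateCarriersOfRecord₁₃CoPH 𝔯 F θ hP g₀ os k).ne3.Nper = ne3NperOfRecord₁₁ F 0 0 ∧
      (rateCarriersOfRecord₁₃CoPH 𝔯 F θ hP g₀ os k).ne3.L = F.L := by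
  rw [rateCarriers_ne3_of_pinnedLoose hpin F θ hP g₀ os k]
  exact ⟨rfl, rfl, rfl, rfl, rfl⟩

end

end Summit.QuantumFields.YangMills.BalabanUVNodes.N16PinnedLooseMatch
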